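import Summits.QuantumFields.YangMills.Theorems.BalabanLadderUVSeamRecUnitTransferPrep
import HarnessLib

/-!
# Crux `UVSeamRec` (stmt-QuantumFields-20043), stub `stub_floors`: unit transfer of the floors — III, three-point

Helper file (`--supports stmt-QuantumFields-20043`), part III of the series `BalabanLadderUVSeamRecUnitTransfer*`.

WHAT THE PINNED UNIT COSTS (the series `BalabanLadderUVSeamRecUnitTransfer*`).  The registered stub `stub_floors` of
crux `UVSeamRec` (stmt-QuantumFields-20043) asks for the non-triviality floors `LowerBounds SU(2) r uRec` at the
two-loop unit of record `uRec`.  Any engine (the NT line's femto package through the landed `stub_lower`, or Track A's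
N32′) delivers floors at ITS OWN unit `a`, with COMPACTLY SUPPORTED bump witnesses (all `stub_lower` ever produces).
The series proves that such floors move to any unit `u` with `a β / u β → c₀ ∈ (0, ∞)` (asymptotic two-loop scaling of
the engine's unit up to a constant) PROVIDED the density ceilings `MomentBounds G r u` (a fortiori the plane-resolved
`MomentBounds6 G r u` of the ceilings stub) hold at the target unit; mere two-sided comparability `c ≤ a/u ≤ C` does
not suffice by this argument (a floor for one witness does not control its dilates).

This file: `threePoint_transfer` — at ratio one the connected three-point floor `ε ≤ |Q3(f, g, h)|` at unit `a` for
three compactly supported bumps with pairwise disjoint supports yields `ε/2 ≤ |Q3(f, g, h)|` at unit `u` for the SAME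
witnesses, given the density ceilings at `u` (collar bound `(C/R⁴)³`, count `≍ u(β)⁻¹²`, exact cancellation).
-/

set_option autoImplicit false

noncomputable section

open scoped SchwartzMap BigOperators
open MeasureTheory Filter Topology Metric
open Literature.MathematicalPhysics.QuantumFieldTheory Literature.MathematicalPhysics.QuantumLattice
open Literature.Probability.LatticeModels (box Site mem_box card_box)
open Summit.QuantumFields.YangMills.Cruxes.OSLegsFromFemtoAndGap.DlrCollarTransfer
open Summit.QuantumFields.YangMills.Theorems.OSLegsFromFemtoAndGap

namespace Summit.QuantumFields.YangMills.Cruxes.UVSeamRec.UnitTransfer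

variable {G : Type} [Group G] [TopologicalSpace G] [IsTopologicalGroup G] [CompactSpace G]
  [MeasurableSpace G] [BorelSpace G]

/-! ### The three-point transfer at ratio one -/

/-- **Three-point floor transfer at ratio one.**  Floors `ε ≤ |Q3(f, g, h)|` at unit `a` for three compactly supported
bumps with pairwise disjoint supports, density ceilings at unit `u`, `u → 0⁺` and `a/u → 1` give the floor
`ε/2 ≤ |Q3(f, g, h)|` at unit `u` for the SAME witnesses. [folklore] -/
theorem threePoint_transfer (r : LatticeRep G) {a u : ℝ → ℝ} (ha : ∀ β, 0 < a β) (hu : ∀ β, 0 < u β)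
    (hu0 : Tendsto u atTop (𝓝 0)) (hau : Tendsto (fun β => a β / u β) atTop (𝓝 1))
    (hMB : MomentBounds G r u) (f g h : 𝓢(EuclideanSpace ℝ (Fin 4), ℝ))
    (hfK : HasCompactSupport (f : EuclideanSpace ℝ (Fin 4) → ℝ))
    (hgK : HasCompactSupport (g : EuclideanSpace ℝ (Fin 4) → ℝ))
    (hhK : HasCompactSupport (h : EuclideanSpace ℝ (Fin 4) → ℝ))
    (hfg : Disjoint (tsupport (f : EuclideanSpace ℝ (Fin 4) → ℝ)) (tsupport (g : EuclideanSpace ℝ (Fin 4) → ℝ)))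
    (hgh : Disjoint (tsupport (g : EuclideanSpace ℝ (Fin 4) → ℝ)) (tsupport (h : EuclideanSpace ℝ (Fin 4) → ℝ)))
    (hfh : Disjoint (tsupport (f : EuclideanSpace ℝ (Fin 4) → ℝ)) (tsupport (h : EuclideanSpace ℝ (Fin 4) → ℝ)))
    {ε β₅ Λ₅ : ℝ} (hε : 0 < ε)
    (hfloor : ∀ β : ℝ, β₅ ≤ β → ∀ L : ℕ, Λ₅ ≤ a β * L → ε ≤ |Q3 G r β L (a β) f g h|) :
    ∃ β₅' Λ₅' : ℝ, ∀ β : ℝ, β₅' ≤ β → ∀ L : ℕ, Λ₅' ≤ u β * L → ε / 2 ≤ |Q3 G r β L (u β) f g h| := by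
  classical
  -- support data of the bumps: radii and pairwise separations
  obtain ⟨Mf, hMf, hsf⟩ := exists_radius hfK
  obtain ⟨Mg, hMg, hsg⟩ := exists_radius hgK
  obtain ⟨Mh, hMh, hsh⟩ := exists_radius hhK
  set M : ℝ := max Mf (max Mg Mh) with hMdef
  have hM : 1 ≤ M := hMf.trans (le_max_left _ _)
  have hM0 : 0 < M := by linarith
  have hMf' : Mf ≤ M := le_max_left _ _
  have hMg' : Mg ≤ M := (le_max_left _ _).trans (le_max_right _ _)
  have hMh' : Mh ≤ M := (le_max_right _ _).trans (le_max_right _ _)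
  obtain ⟨δ₁, hδ₁, hsep₁⟩ := exists_separation_of_disjoint hfK hfg
  obtain ⟨δ₂, hδ₂, hsep₂⟩ := exists_separation_of_disjoint hgK hgh
  obtain ⟨δ₃, hδ₃, hsep₃⟩ := exists_separation_of_disjoint hfK hfh
  set δ₀ : ℝ := min δ₁ (min δ₂ δ₃) with hδ₀def
  have hδ₀ : 0 < δ₀ := lt_min hδ₁ (lt_min hδ₂ hδ₃)
  have hδ₀₁ : δ₀ ≤ δ₁ := min_le_left _ _
  have hδ₀₂ : δ₀ ≤ δ₂ := (min_le_right _ _).trans (min_le_left _ _)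
  have hδ₀₃ : δ₀ ≤ δ₃ := (min_le_right _ _).trans (min_le_right _ _)
  set δ : ℝ := δ₀ / 4 with hδdef
  have hδ : 0 < δ := by positivity
  clear_value M δ₀ δ
  -- sup bounds of the bumps
  set B : ℝ := SchwartzMap.seminorm ℝ 0 0 f + SchwartzMap.seminorm ℝ 0 0 g + SchwartzMap.seminorm ℝ 0 0 h with hB
  have hBf : ∀ z, |f z| ≤ B := fun z => by
    have h' := SchwartzMap.norm_le_seminorm ℝ f z
    rw [Real.norm_eq_abs] at h'
    have := apply_nonneg (SchwartzMap.seminorm ℝ 0 0) g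
    have := apply_nonneg (SchwartzMap.seminorm ℝ 0 0) h
    linarith
  have hBg : ∀ z, |g z| ≤ B := fun z => by
    have h' := SchwartzMap.norm_le_seminorm ℝ g z
    rw [Real.norm_eq_abs] at h'
    have := apply_nonneg (SchwartzMap.seminorm ℝ 0 0) f
    have := apply_nonneg (SchwartzMap.seminorm ℝ 0 0) h
    linarith
  have hBh : ∀ z, |h z| ≤ B := fun z => by
    have h' := SchwartzMap.norm_le_seminorm ℝ h z
    rw [Real.norm_eq_abs] at h'
    have := apply_nonneg (SchwartzMap.seminorm ℝ 0 0) f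
    have := apply_nonneg (SchwartzMap.seminorm ℝ 0 0) g
    linarith
  have hB0 : 0 ≤ B := (abs_nonneg _).trans (hBf 0)
  clear_value B
  -- the ceilings
  obtain ⟨C, β₄, ℓ₄, hℓ₄, hC, H⟩ := abs_torusMoment_le_of_momentBounds r hMB
  -- constants
  set ρ : ℝ := min (δ / 4) ℓ₄ with hρdef
  have hρ : 0 < ρ := lt_min (by positivity) hℓ₄
  have hρδ : ρ ≤ δ / 4 := min_le_left _ _
  have hρℓ : ρ ≤ ℓ₄ := min_le_right _ _
  clear_value ρ
  set K₀ : ℝ := (14 * M / ρ) ^ 12 * (3 * B ^ 2 * C ^ 3) with hK₀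
  have hK₀0 : 0 ≤ K₀ := by positivity
  set η : ℝ := ε / (2 * (K₀ + 1)) with hη
  have hη0 : 0 < η := by positivity
  have hKη : K₀ * η ≤ ε / 2 := by
    rw [hη, mul_div_assoc', div_le_div_iff₀ (by positivity) (by positivity)]
    nlinarith [hK₀0, hε]
  clear_value K₀ η
  -- moduli of continuity
  obtain ⟨θf, hθf, hmodf⟩ := exists_modulus f hfK hη0
  obtain ⟨θg, hθg, hmodg⟩ := exists_modulus g hgK hη0
  obtain ⟨θh, hθh, hmodh⟩ := exists_modulus h hhK hη0
  set θ₀ : ℝ := min θf (min θg θh) with hθ₀def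
  have hθ₀ : 0 < θ₀ := lt_min hθf (lt_min hθg hθh)
  have hθ₀f : θ₀ ≤ θf := min_le_left _ _
  have hθ₀g : θ₀ ≤ θg := (min_le_right _ _).trans (min_le_left _ _)
  have hθ₀h : θ₀ ≤ θh := (min_le_right _ _).trans (min_le_right _ _)
  clear_value θ₀
  -- eventual scale bookkeeping
  obtain ⟨β₀, hβ₀⟩ := eventually_scales hu hu0 hau β₄ β₅ hM hθ₀ hδ hρ
  refine ⟨β₀, max (2 * Λ₅) (max (4 * M) (4 * ρ + 8)), fun β hβ L hL => ?_⟩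
  obtain ⟨hβ₄, hβ₅, halo, hahi, hu1, hθ, huδ, huρ⟩ := hβ₀ β hβ
  have huβ := hu β
  have haβ := ha β
  have hL1 : 2 * Λ₅ ≤ u β * L := (le_max_left _ _).trans hL
  have hL2 : 4 * M ≤ u β * L := ((le_max_left _ _).trans (le_max_right _ _)).trans hL
  have hL3 : 4 * ρ + 8 ≤ u β * L := ((le_max_right _ _).trans (le_max_right _ _)).trans hL
  have hLpos : (0 : ℝ) ≤ L := Nat.cast_nonneg L
  -- the floor at unit `a` applies on this torus
  have hfl : ε ≤ |Q3 G r β L (a β) f g h| := by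
    refine hfloor β hβ₅ L ?_
    have h' : u β / 2 * L ≤ a β * L := mul_le_mul_of_nonneg_right halo hLpos
    linarith
  -- the collar radius
  obtain ⟨hR1, hRu, hRlo⟩ := collar_radius hρ huβ huρ
  set R : ℕ := ⌊ρ / u β⌋₊ with hRdef
  clear_value R
  have hRpos : (0 : ℝ) < R := by exact_mod_cast hR1
  have hRℓ : (R : ℝ) * u β ≤ ℓ₄ := hRu.trans hρℓ
  have hRL : 4 * R + 8 ≤ L := by
    have h' : (4 * (R : ℝ) + 8) * u β ≤ (L : ℝ) * u β := by
      have e1 : (4 * (R : ℝ) + 8) * u β = 4 * ((R : ℝ) * u β) + 8 * u β := by ring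
      have e2 : (L : ℝ) * u β = u β * L := mul_comm _ _
      rw [e1, e2]
      linarith [hRu, hL3, hu1, huβ]
    have h'' : (4 * (R : ℝ) + 8) ≤ (L : ℝ) := le_of_mul_le_mul_right h' huβ
    exact_mod_cast h''
  have hsepR : 2 * (R : ℝ) + 4 ≤ δ / u β := by
    have h1 : (R : ℝ) ≤ ρ / u β := by rw [le_div_iff₀ huβ]; exact hRu
    have h2 : ρ / u β ≤ δ / 4 / u β := div_le_div_of_nonneg_right hρδ huβ.le
    have h3 : 4 ≤ δ / 2 / u β := by rw [le_div_iff₀ huβ]; linarith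
    have h4 : δ / u β = δ / 4 / u β + δ / 4 / u β + δ / 2 / u β := by ring
    linarith
  -- the pointwise ceiling `(C/R⁴)³ ≤ C³ (2u/ρ)¹²`
  have hw : (C / (R : ℝ) ^ 4) ^ 3 ≤ C ^ 3 * (2 * u β / ρ) ^ 12 := by
    have hinv : 1 / (R : ℝ) ≤ 2 * u β / ρ := by
      rw [div_le_div_iff₀ hRpos hρ]
      have h' := hRlo
      rw [div_le_iff₀ (by positivity)] at h'
      linarith
    have h0 : 0 ≤ 1 / (R : ℝ) := by positivity
    calc (C / (R : ℝ) ^ 4) ^ 3 = C ^ 3 * (1 / R) ^ 12 := by ring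
      _ ≤ C ^ 3 * (2 * u β / ρ) ^ 12 := by gcongr
  have hw0 : 0 ≤ C ^ 3 * (2 * u β / ρ) ^ 12 := by positivity
  -- the ceilings at `(β, L, R)`
  have Hβ : ∀ (n : ℕ) (x : Fin n → Site 4),
      (∀ i j : Fin n, i ≠ j → ∃ k : Fin 4,
        (2 * (R : ℤ) + 4) ≤ |((((x i k - x j k : ℤ) : ZMod (2 * L + 1))).valMinAbs : ℤ)|) →
      |torusMoment r.ρ β L r.curvature.F (wilsonTorusMean r.ρ β L r.curvature.F) x| ≤ (C / (R : ℝ) ^ 4) ^ n :=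
    fun n x hx => H β hβ₄ L n x R hR1 hRℓ hRL hx
  -- geometry of a contributing triple at an admissible scale
  have key : ∀ s : ℝ, u β / 2 ≤ s → s ≤ 2 * u β → ∀ x y z : Site 4,
      f (s • siteToE x) * g (s • siteToE y) * h (s • siteToE z) ≠ 0 →
      ‖siteToE x‖ ≤ 2 * M / u β ∧ ‖siteToE y‖ ≤ 2 * M / u β ∧ ‖siteToE z‖ ≤ 2 * M / u β ∧
        δ / u β ≤ ‖x - y‖ ∧ δ / u β ≤ ‖x - z‖ ∧ δ / u β ≤ ‖y - z‖ := by
    intro s hslo hshi x y z hne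
    have hs : 0 < s := by linarith
    obtain ⟨h12, h3⟩ := mul_ne_zero_iff.1 hne
    obtain ⟨h1, h2⟩ := mul_ne_zero_iff.1 h12
    have hMs : M / s ≤ 2 * M / u β := by
      rw [div_le_div_iff₀ hs huβ]
      have h' : M * u β ≤ M * (2 * s) := mul_le_mul_of_nonneg_left (by linarith) hM0.le
      linarith
    have hrad : ∀ (X : EuclideanSpace ℝ (Fin 4)) (M' : ℝ), M' ≤ M → ‖s • X‖ ≤ M' → ‖X‖ ≤ 2 * M / u β := by
      intro X M' hM' hX
      rw [norm_smul, Real.norm_of_nonneg hs.le] at hX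
      calc ‖X‖ ≤ M / s := by rw [le_div_iff₀ hs, mul_comm]; exact hX.trans hM'
        _ ≤ 2 * M / u β := hMs
    have hds : ∀ (x' y' : Site 4) (δ' : ℝ), δ₀ ≤ δ' → δ' ≤ ‖s • siteToE x' - s • siteToE y'‖ →
        δ / u β ≤ ‖x' - y'‖ := by
      intro x' y' δ' hδ' hxy
      have h' : δ₀ / (2 * s) ≤ ‖x' - y'‖ := norm_sub_ge_of_sep hs x' y' (hδ'.trans hxy)
      refine le_trans ?_ h'
      rw [hδdef, div_le_div_iff₀ huβ (by positivity)]
      have h'' : δ₀ * (2 * s) ≤ δ₀ * (4 * u β) := mul_le_mul_of_nonneg_left (by linarith) hδ₀.le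
      linarith
    refine ⟨hrad _ Mf hMf' (hsf _ h1), hrad _ Mg hMg' (hsg _ h2), hrad _ Mh hMh' (hsh _ h3),
      hds x y δ₁ hδ₀₁ (hsep₁ _ _ h1 h2), hds x z δ₃ hδ₀₃ (hsep₃ _ _ h1 h3), hds y z δ₂ hδ₀₂ (hsep₂ _ _ h2 h3)⟩
  -- sup norm from the Euclidean norm of the position
  have hsup : ∀ x : Site 4, ‖x‖ ≤ ‖siteToE x‖ := fun x => by
    simpa using mul_norm_le_norm_smul_siteToE zero_le_one x
  -- the box containing every contributing site
  set N : ℕ := ⌈2 * M / u β⌉₊ with hNdef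
  have hNge : 2 * M / u β ≤ (N : ℝ) := Nat.le_ceil _
  have hNle : (N : ℝ) ≤ 2 * M / u β + 1 := (Nat.ceil_lt_add_one (by positivity)).le
  have hmemT : ∀ x : Site 4, ‖siteToE x‖ ≤ 2 * M / u β → x ∈ box 4 N := fun x hx =>
    mem_box_of_norm_le x ((hsup x).trans (hx.trans hNge))
  have h4M : 4 * M / u β ≤ (L : ℝ) := by rw [div_le_iff₀ huβ]; linarith [hL2]
  have hbulk : ∀ x : Site 4, ‖siteToE x‖ ≤ 2 * M / u β → 2 * ‖x‖ ≤ (L : ℝ) := fun x hx => by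
    calc 2 * ‖x‖ ≤ 2 * (2 * M / u β) := by linarith [hsup x, hx]
      _ = 4 * M / u β := by ring
      _ ≤ L := h4M
  -- closeness of the two smeared positions of a contributing site
  have hua : |u β - a β| = u β * |1 - a β / u β| := by
    have h' : u β - a β = u β * (1 - a β / u β) := by field_simp
    rw [h', abs_mul, abs_of_pos huβ]
  have hclose : ∀ X : EuclideanSpace ℝ (Fin 4), ‖X‖ ≤ 2 * M / u β → ‖u β • X - a β • X‖ < θ₀ := by
    intro X hX
    rw [← sub_smul, norm_smul, Real.norm_eq_abs, hua]
    calc u β * |1 - a β / u β| * ‖X‖ ≤ u β * |1 - a β / u β| * (2 * M / u β) :=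
          mul_le_mul_of_nonneg_left hX (by positivity)
      _ = 2 * M * |1 - a β / u β| := by field_simp
      _ < θ₀ := hθ
  -- the two sums as weighted sums over `box × (box × box)`
  have hQ3 : ∀ s : ℝ, Q3 G r β L s f g h = ∑ p ∈ box 4 L ×ˢ (box 4 L ×ˢ box 4 L),
      (f (s • siteToE p.1) * g (s • siteToE p.2.1) * h (s • siteToE p.2.2)) * torusK3 G r β L p.1 p.2.1 p.2.2 := by
    intro s
    unfold Q3
    rw [Finset.sum_product]
    refine Finset.sum_congr rfl fun x _ => ?_
    rw [Finset.sum_product]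
  -- the perturbation estimate
  have hdiff : |Q3 G r β L (u β) f g h - Q3 G r β L (a β) f g h| ≤
      ((box 4 N ×ˢ (box 4 N ×ˢ box 4 N)).card : ℝ) * ((3 * B ^ 2 * η) * (C ^ 3 * (2 * u β / ρ) ^ 12)) := by
    rw [hQ3 (u β), hQ3 (a β)]
    refine abs_sum_mul_sub_sum_mul_le _ _ _ _ _ (by positivity) hw0 fun p _ hp => ?_
    have hgeo : ‖siteToE p.1‖ ≤ 2 * M / u β ∧ ‖siteToE p.2.1‖ ≤ 2 * M / u β ∧ ‖siteToE p.2.2‖ ≤ 2 * M / u β ∧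
        δ / u β ≤ ‖p.1 - p.2.1‖ ∧ δ / u β ≤ ‖p.1 - p.2.2‖ ∧ δ / u β ≤ ‖p.2.1 - p.2.2‖ := by
      rcases hp with hp | hp
      · exact key (u β) (by linarith) (by linarith) p.1 p.2.1 p.2.2 hp
      · exact key (a β) halo hahi p.1 p.2.1 p.2.2 hp
    obtain ⟨hx, hy, hz, hxy, hxz, hyz⟩ := hgeo
    refine ⟨Finset.mem_product.2 ⟨hmemT _ hx, Finset.mem_product.2 ⟨hmemT _ hy, hmemT _ hz⟩⟩, ?_, ?_⟩
    · exact (abs_torusK3_le r Hβ p.1 p.2.1 p.2.2 (hbulk _ hx) (hbulk _ hy) (hbulk _ hz)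
        (hsepR.trans hxy) (hsepR.trans hxz) (hsepR.trans hyz)).trans hw
    · have d1 : |f (u β • siteToE p.1) - f (a β • siteToE p.1)| < η :=
        hmodf _ _ ((hclose _ hx).trans_le hθ₀f)
      have d2 : |g (u β • siteToE p.2.1) - g (a β • siteToE p.2.1)| < η :=
        hmodg _ _ ((hclose _ hy).trans_le hθ₀g)
      have d3 : |h (u β • siteToE p.2.2) - h (a β • siteToE p.2.2)| < η :=
        hmodh _ _ ((hclose _ hz).trans_le hθ₀h)
      set f₁ := f (u β • siteToE p.1)
      set f₂ := f (a β • siteToE p.1)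
      set g₁ := g (u β • siteToE p.2.1)
      set g₂ := g (a β • siteToE p.2.1)
      set h₁ := h (u β • siteToE p.2.2)
      set h₂ := h (a β • siteToE p.2.2)
      have hid : f₁ * g₁ * h₁ - f₂ * g₂ * h₂ =
          (f₁ - f₂) * g₁ * h₁ + (f₂ * (g₁ - g₂) * h₁ + f₂ * g₂ * (h₁ - h₂)) := by ring
      rw [hid]
      have t1 : |f₁ - f₂| * |g₁| * |h₁| ≤ η * B * B :=
        mul_le_mul (mul_le_mul d1.le (hBg _) (abs_nonneg _) hη0.le) (hBh _) (abs_nonneg _) (by positivity)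
      have t2 : |f₂| * |g₁ - g₂| * |h₁| ≤ B * η * B :=
        mul_le_mul (mul_le_mul (hBf _) d2.le (abs_nonneg _) hB0) (hBh _) (abs_nonneg _) (by positivity)
      have t3 : |f₂| * |g₂| * |h₁ - h₂| ≤ B * B * η :=
        mul_le_mul (mul_le_mul (hBf _) (hBg _) (abs_nonneg _) hB0) d3.le (abs_nonneg _) (by positivity)
      calc |(f₁ - f₂) * g₁ * h₁ + (f₂ * (g₁ - g₂) * h₁ + f₂ * g₂ * (h₁ - h₂))|
          ≤ |(f₁ - f₂) * g₁ * h₁| + |f₂ * (g₁ - g₂) * h₁ + f₂ * g₂ * (h₁ - h₂)| := abs_add_le _ _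
        _ ≤ |(f₁ - f₂) * g₁ * h₁| + (|f₂ * (g₁ - g₂) * h₁| + |f₂ * g₂ * (h₁ - h₂)|) :=
            add_le_add le_rfl (abs_add_le (f₂ * (g₁ - g₂) * h₁) (f₂ * g₂ * (h₁ - h₂)))
        _ = |f₁ - f₂| * |g₁| * |h₁| + (|f₂| * |g₁ - g₂| * |h₁| + |f₂| * |g₂| * |h₁ - h₂|) := by
            simp only [abs_mul]
        _ ≤ η * B * B + (B * η * B + B * B * η) := add_le_add t1 (add_le_add t2 t3)
        _ = 3 * B ^ 2 * η := by ring
  -- count the box and conclude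
  obtain ⟨t, ht⟩ : ∃ t : ℝ, t = ((2 * N + 1 : ℕ) : ℝ) := ⟨_, rfl⟩
  have hcard : ((box 4 N ×ˢ (box 4 N ×ˢ box 4 N)).card : ℝ) = t ^ 12 := by
    rw [Finset.card_product, Finset.card_product, card_box, ht]; push_cast; ring
  have ht0 : 0 ≤ t := by rw [ht]; positivity
  have ht7 : t ≤ 7 * M / u β := by
    rw [ht]
    push_cast
    have h3 : (3 : ℝ) ≤ 3 * M / u β := by
      rw [le_div_iff₀ huβ]; linarith only [hM, hu1]
    calc 2 * (N : ℝ) + 1 ≤ 2 * (2 * M / u β + 1) + 1 := by linarith only [hNle]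
      _ = 4 * M / u β + 3 := by ring
      _ ≤ 4 * M / u β + 3 * M / u β := by linarith only [h3]
      _ = 7 * M / u β := by ring
  clear_value N
  have h14 : (7 * M / u β) * (2 * u β / ρ) = 14 * M / ρ := by
    field_simp
    ring
  have hX0 : 0 ≤ (3 * B ^ 2 * η) * (C ^ 3 * (2 * u β / ρ) ^ 12) := by positivity
  have hbound : (t ^ 12) * ((3 * B ^ 2 * η) * (C ^ 3 * (2 * u β / ρ) ^ 12)) ≤ K₀ * η := by
    have h12 : t ^ 12 ≤ (7 * M / u β) ^ 12 := pow_le_pow_left₀ ht0 ht7 12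
    calc t ^ 12 * ((3 * B ^ 2 * η) * (C ^ 3 * (2 * u β / ρ) ^ 12))
        ≤ (7 * M / u β) ^ 12 * ((3 * B ^ 2 * η) * (C ^ 3 * (2 * u β / ρ) ^ 12)) :=
          mul_le_mul_of_nonneg_right h12 hX0
      _ = ((7 * M / u β) * (2 * u β / ρ)) ^ 12 * (3 * B ^ 2 * C ^ 3) * η := by ring
      _ = (14 * M / ρ) ^ 12 * (3 * B ^ 2 * C ^ 3) * η := by rw [h14]
      _ = K₀ * η := by rw [hK₀]
  rw [hcard] at hdiff
  have hfin : |Q3 G r β L (u β) f g h - Q3 G r β L (a β) f g h| ≤ ε / 2 := hdiff.trans (hbound.trans hKη)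
  have htri := abs_sub_abs_le_abs_sub (Q3 G r β L (a β) f g h) (Q3 G r β L (u β) f g h)
  rw [abs_sub_comm] at htri
  linarith [htri, hfin, hfl]

end Summit.QuantumFields.YangMills.Cruxes.UVSeamRec.UnitTransfer

end
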